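import Literature.AlgebraicGeometry.AbelianSchemes.AbelianSchemeBaseChangeComp
import Literature.AlgebraicGeometry.Modules.PullbackAlgebraUnit
import HarnessLib

/-!
# Base change of the dual pair `(Â, 𝒫)` of an abelian scheme (the owed leaf «D2-BC» of
# `AbelianSchemes/AbelianSchemeDualPair`; [MFK94] Ch. 6 §1 Cor. 6.8, [Milne AV] I §8)

Layer `Literature/AlgebraicGeometry/AbelianSchemes`, namespace
`Literature.AlgebraicGeometry.AbelianSchemes.AbelianSchemeOver` (+ two transport lemmas in
`Literature.AlgebraicGeometry.AbelianVarieties`).  Cell `hodgecm-mathlib`, rung-0 carrier junction D-BC∃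
(D2-third); consumers: `PolarizedAbelianSchemeWithLevel.baseChange` / `IsBaseChangeVia` (D4), W1/W3.

`AbelianSchemes/AbelianSchemeDualPair` §4 defines the DATA halves of the base change of a dual pair
`D = (Â, 𝒫)` of `A/S` along `g : S' ⟶ S` — `D.hatBaseChange g = Â ×_S S'`, the comparison
`D.prodBaseChangeToProd g : A_{S'} ×_{S'} Â_{S'} → A ×_S Â` and `D.PBaseChange g` (`𝒫` pulled back along it) —
and records «that `(Â_{S'}, 𝒫_{S'})` is again a dual pair for `A_{S'}` … is the owed leaf D2-BC».  This file pays
it: **`DualPair.baseChange (D) (g) : (A.baseChange g).DualPair`** with the four properties of [MilneAV2008, I §8]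
PROVED for the base-changed data —

* `hasRank_PBaseChange` — `𝒫_{S'}` is a line bundle (pull-back preserves the rank);
* `rigid_PBaseChange` — `(ε × 1)^*𝒫_{S'} ≅ 𝒪` (the unit-slice square `unitSlice_baseChange_comp_prodBaseChangeToProd`,
  resting on `unitSection_baseChange_comp_fst : ε_{A_{S'}} ≫ pr = g ≫ ε_A`, + `f^*𝒪 ≅ 𝒪`);
* `fibrewisePicZero_PBaseChange` — the slice of `𝒫_{S'}` over a geometric point `b'` of `Â_{S'}` is translation
  invariant: through **`fibreBaseChangeIso (g) (t) : ((A.baseChange g).fibre t) ≅ (A.fibre (t ≫ g))`** (as abelian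
  varieties — Mathlib's `Over.pullbackComp` is monoidal, lifted by `Functor.mapGrpNatIso`; the affine-base pattern of
  ★ `AbelianScheme.fibreBaseChangeIso`) it is the slice of `𝒫` over `b' ≫ pr_Â`
  (`fibreSlice_baseChange_comp_prodBaseChangeToProd`), and homogeneity moves along isomorphisms of abelian varieties
  (`AbelianVarieties.isHomogeneous_pullback_iff_of_iso`, [MumfordAV1970] §4 + §8);
* `universal_baseChange` — a rigidified fibrewise-`Pic⁰` line bundle on `(A_{S'})_T` IS one on `A_T` over
  `f' ≫ g` (`RigidifiedLineBundle.alongBaseChange`, through the group-scheme isomorphism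
  **`baseChangeCompGrpIso (g) (f') : A_{f' ≫ g} ≅ (A_{S'})_{f'}`**), so it is classified by a unique `T → Â` over `S`,
  i.e. by a unique `T → Â ×_S S'` over `S'` ([MilneAV2008, I §8]: restrict the universal property to `S`-schemes
  through `S'`); `classify_baseChange_comp_fst` records `g'_ℒ ≫ pr_Â = g_{ℒ.alongBaseChange}`.

Everything is proved; the file introduces no named fact, no instance, no notation; its definitions are
isomorphisms / transported data with bodies (`RigidifiedLineBundle.alongBaseChange`, `DualPair.sliceOver`, `DualPair.pullbackPBaseChangeIso`, `DualPair.baseChange`); the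
group-scheme / fibre isomorphisms `baseChangeCompGrpIso`, `fibreBaseChangeIso`, `fibreAlongBaseChangeIso` and the transport of
homogeneity are `AbelianSchemes/AbelianSchemeBaseChangeComp`.

## References
* [MumfordFogartyKirwan1994] D. Mumford, J. Fogarty, F. Kirwan, *Geometric Invariant Theory*, 3rd ed. (1994), Ch. 6 §1
  Cor. 6.8 (p. 118), §2 (p. 121), Ch. 7 §2 Def. 7.2 (p. 129).
* [MilneAV2008] J. S. Milne, *Abelian Varieties* (v2.00, 2008), I §8 pp. 36–37.
* [MumfordAV1970] D. Mumford, *Abelian Varieties* (1970), §4 (Cor. 1 of rigidity), §8 ((iv) ⇔ (i)).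
* [GortzWedhorn2020] U. Görtz, T. Wedhorn, *Algebraic Geometry I*, 2nd ed. (2020), Section (4.7), Prop. 4.16, Remark 16.54.
* [Mukai1978] S. Mukai, *Semi-homogeneous vector bundles on an abelian variety* (1978), Def. 4.4.
-/

universe u

open CategoryTheory CategoryTheory.Limits AlgebraicGeometry MonoidalCategory

noncomputable section

namespace Literature.AlgebraicGeometry.AbelianSchemes

open Literature.AlgebraicGeometry.Motives Literature.AlgebraicGeometry.AbelianVarieties
  Literature.AlgebraicGeometry.Modules
open scoped MonObj CategoryTheory.Obj

namespace AbelianSchemeOver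

variable {S S' T : Scheme.{u}} (A : AbelianSchemeOver S) (g : S' ⟶ S)

namespace RigidifiedLineBundle

variable {A} {g} {T : Scheme.{u}} {f' : T ⟶ S'} (ℒ : (A.baseChange g).RigidifiedLineBundle f')

/-- **A rigidified line bundle on `(A_{S'})_T` IS one on `A_T` over `f' ≫ g`**: transport along
`A_{f' ≫ g} ≅ (A_{S'})_{f'}`; the rigidification follows the identity sections
(`unitSection_comp_baseChangeCompGrpIso_hom_left`). [cite: MilneAV2008, I §8 pp. 36–37] -/
def alongBaseChange : A.RigidifiedLineBundle (f' ≫ g) where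
  L := (Scheme.Modules.pullback (A.bcHomLeft g f')).obj ℒ.L
  hasRank_one := hasRank_pullback _ ℒ.hasRank_one
  rigid := ℒ.rigid.map fun r =>
    (Scheme.Modules.pullbackComp _ _).app ℒ.L ≪≫
      (Scheme.Modules.pullbackCongr (A.unitSection_comp_baseChangeCompGrpIso_hom_left g f')).app ℒ.L ≪≫ r

/-- The module of `ℒ.alongBaseChange` is `e^* ℒ` (definitional). [cite: MilneAV2008, I §8 pp. 36–37] -/
theorem alongBaseChange_L : ℒ.alongBaseChange.L = (Scheme.Modules.pullback (A.bcHomLeft g f')).obj ℒ.L :=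
  rfl

variable {ℒ} in
/-- `ℒ.alongBaseChange` is fibrewise in `Pic⁰` if `ℒ` is (the fibres correspond under `fibreAlongBaseChangeIso`).
[cite: MilneAV2008, I §8 pp. 36–37] [cite: MumfordAV1970, §8 ((iv) ⇔ (i))] -/
theorem alongBaseChange_fibrewisePicZero (h : ℒ.FibrewisePicZero) : ℒ.alongBaseChange.FibrewisePicZero := by
  intro Ω _ _ u
  have h1 := (isHomogeneous_pullback_iff_of_iso (A.fibreAlongBaseChangeIso g f' u) _).2 (h Ω u)
  refine (isHomogeneous_iff_of_iso _ ?_).1 h1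
  -- `ψ^* pr^* ℒ ≅ (ψ ≫ pr)^* ℒ = (pr ≫ e)^* ℒ ≅ pr^* e^* ℒ`
  exact (Scheme.Modules.pullbackComp _ _).app ℒ.L ≪≫
    (Scheme.Modules.pullbackCongr (A.fibreAlongBaseChangeIso_hom_toSchemeHom_fst g f' u)).app ℒ.L ≪≫
    ((Scheme.Modules.pullbackComp _ _).app ℒ.L).symm

end RigidifiedLineBundle

/-! ### §1 Base change of a dual pair: rank and rigidity of `𝒫_{S'}` -/

namespace DualPair

variable {A} (D : A.DualPair)

/-- **(bc1) `𝒫_{S'}` is a line bundle** (pull-back preserves the rank). [cite: MumfordFogartyKirwan1994, Ch. 6 §1 Cor. 6.8 (p. 118)] -/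
theorem hasRank_PBaseChange : HasRank (D.PBaseChange g) 1 :=
  hasRank_pullback _ D.hasRank_one

/-- The unit-slice square for the base change: `(ε_{A_{S'}} × 1) ≫ (A_{S'} ×_{S'} Â_{S'} → A ×_S Â) = pr_Â ≫ (ε_A × 1)`.
[cite: MumfordFogartyKirwan1994, Ch. 6 §2 (p. 121)] -/
@[reassoc]
theorem unitSlice_baseChange_comp_prodBaseChangeToProd :
    (A.baseChange g).unitSlice (D.hatBaseChange g) ≫ D.prodBaseChangeToProd g =
      pullback.fst D.hat.X.hom g ≫ A.unitSlice D.hat := by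
  apply pullback.hom_ext
  · simp only [AbelianSchemeOver.unitSlice, DualPair.prodBaseChangeToProd, Category.assoc, pullback.lift_fst,
      pullback.lift_fst_assoc]
    rw [unitSection_baseChange_comp_fst]
    change pullback.snd D.hat.X.hom g ≫ g ≫ A.unitSection = _
    rw [← Category.assoc, ← pullback.condition, Category.assoc]
    symm
    erw [Category.assoc, pullback.lift_fst]
    rfl
  · simp only [AbelianSchemeOver.unitSlice, DualPair.prodBaseChangeToProd, Category.assoc, pullback.lift_snd,
      pullback.lift_snd_assoc, Category.id_comp]
    symm
    erw [Category.assoc, pullback.lift_snd, Category.comp_id]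

/-- **(bc2) `𝒫_{S'}` is rigidified along `ε_{A_{S'}} × 1`**: `(ε × 1)^* 𝒫_{S'} ≅ pr^* (ε × 1)^* 𝒫 ≅ pr^* 𝒪_Â ≅ 𝒪_{Â_{S'}}`.
[cite: MumfordFogartyKirwan1994, Ch. 6 §2 (p. 121)] -/
theorem rigid_PBaseChange :
    Nonempty ((Scheme.Modules.pullback ((A.baseChange g).unitSlice (D.hatBaseChange g))).obj (D.PBaseChange g) ≅
      SheafOfModules.unit _) := by
  obtain ⟨r⟩ := D.rigid
  refine ⟨(Scheme.Modules.pullbackComp _ _).app D.P ≪≫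
    (Scheme.Modules.pullbackCongr (D.unitSlice_baseChange_comp_prodBaseChangeToProd g)).app D.P ≪≫
    ((Scheme.Modules.pullbackComp _ _).app D.P).symm ≪≫
    (Scheme.Modules.pullback (pullback.fst D.hat.X.hom g)).mapIso r ≪≫ ?_⟩
  have hI : IsIso (SheafOfModules.pullbackObjUnitToUnit (pullback.fst D.hat.X.hom g).toRingCatSheafHom) := by
    haveI := Literature.AlgebraicGeometry.KTheory.final_opensMap (pullback.fst D.hat.X.hom g)
    exact SheafOfModules.instIsIsoPullbackObjUnitToUnitOfFinal _
  exact @asIso _ _ _ _ (SheafOfModules.pullbackObjUnitToUnit (pullback.fst D.hat.X.hom g).toRingCatSheafHom) hI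

/-! ### §2 Base change of a dual pair: `𝒫_{S'}` lies fibrewise in `Pic⁰` -/

/-- The slice `a ↦ (a, b)` of the fibre `A_s` into `A ×_S Â` over an ARBITRARY presentation `s` of the base point
of `b` (`b ≫ π̂ = s`); for `s := b ≫ π̂` it is `A.fibreSlice Â b` on the nose (non-Prop plumbing used to move the
base point along an equality of morphisms). [cite: MilneAV2008, I §8 pp. 36–37] -/
def sliceOver {Ω : Type u} [Field Ω] (b : Spec (.of Ω) ⟶ D.hat.X.left) (s : Spec (.of Ω) ⟶ S)
    (hs : b ≫ D.hat.X.hom = s) : pullback A.X.hom s ⟶ A.prodLeft D.hat :=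
  pullback.lift (pullback.fst A.X.hom s) (pullback.snd A.X.hom s ≫ b) (by rw [pullback.condition, Category.assoc, hs])

/-- First projection of `sliceOver`. [cite: MilneAV2008, I §8 pp. 36–37] -/
@[reassoc (attr := simp)]
theorem sliceOver_fst {Ω : Type u} [Field Ω] (b : Spec (.of Ω) ⟶ D.hat.X.left) (s : Spec (.of Ω) ⟶ S)
    (hs : b ≫ D.hat.X.hom = s) : D.sliceOver b s hs ≫ pullback.fst A.X.hom D.hat.X.hom = pullback.fst A.X.hom s :=
  pullback.lift_fst _ _ _

/-- Second projection of `sliceOver`. [cite: MilneAV2008, I §8 pp. 36–37] -/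
@[reassoc (attr := simp)]
theorem sliceOver_snd {Ω : Type u} [Field Ω] (b : Spec (.of Ω) ⟶ D.hat.X.left) (s : Spec (.of Ω) ⟶ S)
    (hs : b ≫ D.hat.X.hom = s) :
    D.sliceOver b s hs ≫ pullback.snd A.X.hom D.hat.X.hom = pullback.snd A.X.hom s ≫ b :=
  pullback.lift_snd _ _ _

/-- `𝒫` is translation invariant on the slice over any presentation of the base point (`subst` to the
defining `fibrewisePicZero`). [cite: MumfordAV1970, §8 ((iv) ⇔ (i))] -/
theorem isHomogeneous_pullback_sliceOver {Ω : Type u} [Field Ω] [IsAlgClosed Ω]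
    (b : Spec (.of Ω) ⟶ D.hat.X.left) {s : Spec (.of Ω) ⟶ S} (hs : b ≫ D.hat.X.hom = s) :
    IsHomogeneous (A.fibre s).toAbelianVariety ((Scheme.Modules.pullback (D.sliceOver b s hs)).obj D.P) := by
  subst hs
  exact D.fibrewisePicZero Ω b

/-- The base point of `b' ≫ pr_Â` is `(b' ≫ π̂_{S'}) ≫ g`. [cite: MilneAV2008, I §8 pp. 36–37] -/
theorem comp_fst_comp_hat_hom {Ω : Type u} [Field Ω] (b' : Spec (.of Ω) ⟶ (D.hatBaseChange g).X.left) :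
    (b' ≫ pullback.fst D.hat.X.hom g) ≫ D.hat.X.hom = (b' ≫ (D.hatBaseChange g).X.hom) ≫ g :=
  (Category.assoc _ _ _).trans
    ((congrArg (fun k => b' ≫ k) (pullback.condition (f := D.hat.X.hom) (g := g))).trans
      (Category.assoc _ _ _).symm)

/-- The fibre-slice square for the base change: `(A_{S'})_t → A_{S'} ×_{S'} Â_{S'} → A ×_S Â` is the fibre
identification `(A_{S'})_t ≅ A_{t ≫ g}` followed by the slice of `A_{t ≫ g}` at `b := b' ≫ pr_Â`.
[cite: MilneAV2008, I §8 pp. 36–37] -/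
theorem fibreSlice_baseChange_comp_prodBaseChangeToProd {Ω : Type u} [Field Ω]
    (b' : Spec (.of Ω) ⟶ (D.hatBaseChange g).X.left) :
    (A.baseChange g).fibreSlice (D.hatBaseChange g) b' ≫ D.prodBaseChangeToProd g =
      AbelianVariety.Hom.toSchemeHom (A.fibreBaseChangeIso g (b' ≫ (D.hatBaseChange g).X.hom)).hom ≫
        D.sliceOver (b' ≫ pullback.fst D.hat.X.hom g) ((b' ≫ (D.hatBaseChange g).X.hom) ≫ g)
          (D.comp_fst_comp_hat_hom g b') := by
  apply pullback.hom_ext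
  · simp only [AbelianSchemeOver.fibreSlice, DualPair.prodBaseChangeToProd, DualPair.sliceOver, Category.assoc,
      pullback.lift_fst, pullback.lift_fst_assoc]
    symm
    erw [Category.assoc, pullback.lift_fst, fibreBaseChangeIso_hom_toSchemeHom_fst]
    rfl
  · simp only [AbelianSchemeOver.fibreSlice, DualPair.prodBaseChangeToProd, DualPair.sliceOver, Category.assoc,
      pullback.lift_snd, pullback.lift_snd_assoc]
    symm
    erw [Category.assoc, pullback.lift_snd,
      A.fibreBaseChangeIso_hom_toSchemeHom_snd_assoc g (b' ≫ (D.hatBaseChange g).X.hom)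
        (b' ≫ pullback.fst D.hat.X.hom g)]
    rfl

/-- **(bc3) `𝒫_{S'}` lies fibrewise in `Pic⁰` over `Â_{S'}`**: the slice of `𝒫_{S'}` over a geometric point `b'` of
`Â_{S'}` is, through `(A_{S'})_t ≅ A_{t ≫ g}`, the slice of `𝒫` over `b' ≫ pr_Â`, which is translation invariant.
[cite: MilneAV2008, I §8 pp. 36–37] [cite: MumfordAV1970, §8 ((iv) ⇔ (i))] -/
theorem fibrewisePicZero_PBaseChange (Ω : Type u) [Field Ω] [IsAlgClosed Ω]
    (b' : Spec (.of Ω) ⟶ (D.hatBaseChange g).X.left) :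
    IsHomogeneous ((A.baseChange g).fibre (b' ≫ (D.hatBaseChange g).X.hom)).toAbelianVariety
      ((Scheme.Modules.pullback ((A.baseChange g).fibreSlice (D.hatBaseChange g) b')).obj (D.PBaseChange g)) := by
  have h0 := D.isHomogeneous_pullback_sliceOver (b' ≫ pullback.fst D.hat.X.hom g) (D.comp_fst_comp_hat_hom g b')
  have h1 := (isHomogeneous_pullback_iff_of_iso (A.fibreBaseChangeIso g (b' ≫ (D.hatBaseChange g).X.hom)) _).2 h0
  refine (isHomogeneous_iff_of_iso _ ?_).1 h1
  -- `φ^* L^* 𝒫 ≅ (φ ≫ L)^* 𝒫 = (slice' ≫ comparison)^* 𝒫 ≅ slice'^* 𝒫_{S'}`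
  exact (Scheme.Modules.pullbackComp _ _).app D.P ≪≫
    ((Scheme.Modules.pullbackCongr (D.fibreSlice_baseChange_comp_prodBaseChangeToProd g b')).app D.P).symm ≪≫
    ((Scheme.Modules.pullbackComp _ _).app D.P).symm

/-! ### §3 Base change of a dual pair: universality over `S'` -/

section Universal

variable {T : Scheme.{u}} (f' : T ⟶ S')

/-- The base point over `S` of an `S'`-morphism `g' : T → Â_{S'}` over `f'`: `(g' ≫ pr_Â) ≫ π̂ = f' ≫ g`. [cite: MilneAV2008, I §8 pp. 36–37] -/
theorem comp_fst_comp_hat_hom_of_over (g' : T ⟶ (D.hatBaseChange g).X.left)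
    (hg' : g' ≫ (D.hatBaseChange g).X.hom = f') : (g' ≫ pullback.fst D.hat.X.hom g) ≫ D.hat.X.hom = f' ≫ g :=
  (Category.assoc _ _ _).trans ((congrArg (fun k => g' ≫ k) (pullback.condition (f := D.hat.X.hom) (g := g))).trans
    ((Category.assoc _ _ _).symm.trans (congrArg (· ≫ g) hg')))

/-- The comparison square for `1 × g'`: for an `S'`-morphism `g' : T → Â_{S'}` over `f'`,
`(1_{A_{S'}} × g') ≫ (A_{S'} ×_{S'} Â_{S'} → A ×_S Â) = e⁻¹ ≫ (1_A × (g' ≫ pr_Â))`. [cite: MilneAV2008, I §8 pp. 36–37] -/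
theorem baseChangeToProd_baseChange_comp_prodBaseChangeToProd (g' : T ⟶ (D.hatBaseChange g).X.left)
    (hg' : g' ≫ (D.hatBaseChange g).X.hom = f') :
    (A.baseChange g).baseChangeToProd (D.hatBaseChange g) f' g' hg' ≫ D.prodBaseChangeToProd g =
      A.bcInvLeft g f' ≫ A.baseChangeToProd D.hat (f' ≫ g) (g' ≫ pullback.fst D.hat.X.hom g)
        (D.comp_fst_comp_hat_hom_of_over g f' g' hg') := by
  apply pullback.hom_ext
  · simp only [AbelianSchemeOver.baseChangeToProd, DualPair.prodBaseChangeToProd, Category.assoc,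
      pullback.lift_fst, pullback.lift_fst_assoc]
    symm
    erw [Category.assoc, pullback.lift_fst, baseChangeCompGrpIso_inv_left_fst]
    rfl
  · simp only [AbelianSchemeOver.baseChangeToProd, DualPair.prodBaseChangeToProd, Category.assoc,
      pullback.lift_snd, pullback.lift_snd_assoc]
    symm
    erw [Category.assoc, pullback.lift_snd,
      A.baseChangeCompGrpIso_inv_left_snd_assoc g f' (g' ≫ pullback.fst D.hat.X.hom g)]
    rfl

/-- `(1 × g')^* 𝒫_{S'} ≅ (e⁻¹)^* (1 × (g' ≫ pr_Â))^* 𝒫`. [cite: MilneAV2008, I §8 pp. 36–37] -/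
def pullbackPBaseChangeIso (g' : T ⟶ (D.hatBaseChange g).X.left) (hg' : g' ≫ (D.hatBaseChange g).X.hom = f') :
    (Scheme.Modules.pullback ((A.baseChange g).baseChangeToProd (D.hatBaseChange g) f' g' hg')).obj (D.PBaseChange g) ≅
      (Scheme.Modules.pullback (A.bcInvLeft g f')).obj
        (D.pullbackP (f' ≫ g) (g' ≫ pullback.fst D.hat.X.hom g) (D.comp_fst_comp_hat_hom_of_over g f' g' hg')) :=
  (Scheme.Modules.pullbackComp _ _).app D.P ≪≫
    (Scheme.Modules.pullbackCongr (D.baseChangeToProd_baseChange_comp_prodBaseChangeToProd g f' g' hg')).app D.P ≪≫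
    ((Scheme.Modules.pullbackComp _ _).app D.P).symm

/-- **(bc4) UNIVERSALITY of `(Â_{S'}, 𝒫_{S'})` for `A_{S'}`**: a rigidified, fibrewise-`Pic⁰` line bundle `ℒ` on
`(A_{S'})_T` is one on `A_T` over `f' ≫ g`, so it is classified by a unique `g₀ : T → Â` over `S`, i.e. by the unique
`g' = (g₀, f') : T → Â ×_S S' = Â_{S'}` over `S'` ([MilneAV2008, I §8]: restricting the universal property to the
`S`-schemes through `S'`). [cite: MilneAV2008, I §8 pp. 36–37] [cite: MumfordFogartyKirwan1994, Ch. 6 §1 Cor. 6.8 (p. 118)] -/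
theorem universal_baseChange (ℒ : (A.baseChange g).RigidifiedLineBundle f') (hℒ : ℒ.FibrewisePicZero) :
    ∃! g' : {g' : T ⟶ (D.hatBaseChange g).X.left // g' ≫ (D.hatBaseChange g).X.hom = f'},
      Nonempty ((Scheme.Modules.pullback
        ((A.baseChange g).baseChangeToProd (D.hatBaseChange g) f' g'.1 g'.2)).obj (D.PBaseChange g) ≅ ℒ.L) := by
  have hℒ₀ : ℒ.alongBaseChange.FibrewisePicZero := RigidifiedLineBundle.alongBaseChange_fibrewisePicZero hℒ
  have hg₀S : D.classify (f' ≫ g) ℒ.alongBaseChange hℒ₀ ≫ D.hat.X.hom = f' ≫ g := D.classify_comp_hom _ _ _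
  -- existence: `g' := (g₀, f')`
  refine ⟨⟨pullback.lift (D.classify (f' ≫ g) ℒ.alongBaseChange hℒ₀) f' hg₀S, pullback.lift_snd _ _ _⟩, ?_, ?_⟩
  · obtain ⟨i⟩ := D.nonempty_pullbackP_classify_iso (f' ≫ g) ℒ.alongBaseChange hℒ₀
    have hγ : pullback.lift (D.classify (f' ≫ g) ℒ.alongBaseChange hℒ₀) f' hg₀S ≫ pullback.fst D.hat.X.hom g =
        D.classify (f' ≫ g) ℒ.alongBaseChange hℒ₀ := pullback.lift_fst _ _ _
    refine ⟨D.pullbackPBaseChangeIso g f' _ _ ≪≫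
      (Scheme.Modules.pullback (A.bcInvLeft g f')).mapIso
        (eqToIso (D.pullbackP_congr (f' ≫ g) hγ _ hg₀S) ≪≫ i) ≪≫
      A.pullbackInvPullbackHomIso g f' ℒ.L⟩
  · -- uniqueness: `g' ≫ pr_Â` classifies `ℒ.alongBaseChange`, and `g' ≫ π̂_{S'} = f'`
    rintro ⟨g', hg'⟩ ⟨i⟩
    have hγ : g' ≫ pullback.fst D.hat.X.hom g = D.classify (f' ≫ g) ℒ.alongBaseChange hℒ₀ := by
      refine D.eq_classify (f' ≫ g) ℒ.alongBaseChange hℒ₀ _ (D.comp_fst_comp_hat_hom_of_over g f' g' hg') ⟨?_⟩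
      -- `(1 × γ)^*𝒫 ≅ e^* (e⁻¹)^* (1 × γ)^*𝒫 ≅ e^* (1 × g')^* 𝒫_{S'} ≅ e^* ℒ`
      exact (A.pullbackHomPullbackInvIso g f' _).symm ≪≫
        (Scheme.Modules.pullback (A.bcHomLeft g f')).mapIso ((D.pullbackPBaseChangeIso g f' g' hg').symm ≪≫ i)
    apply Subtype.ext
    apply pullback.hom_ext
    · erw [pullback.lift_fst]; exact hγ
    · erw [pullback.lift_snd]; exact hg'

end Universal

/-! ### §4 The base-changed dual pair -/

/-- **BASE CHANGE OF A DUAL PAIR**: `(Â ×_S S', 𝒫 pulled back to A_{S'} ×_{S'} Â_{S'})` is a dual pair for `A_{S'}`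
— [MumfordFogartyKirwan1994, Ch. 6 §1 Cor. 6.8]: formation of the dual abelian scheme commutes with base change
(here: the four defining properties of [MilneAV2008, I §8] transfer — rank and rigidity formally, fibrewise `Pic⁰`
through the fibre identification, universality by restricting to `S`-schemes through `S'`). DATA = the data halves
`hatBaseChange`, `PBaseChange` of `AbelianSchemeDualPair` §4. [cite: MumfordFogartyKirwan1994, Ch. 6 §1 Cor. 6.8 (p. 118)]
[cite: MilneAV2008, I §8 pp. 36–37] -/
def baseChange : (A.baseChange g).DualPair where
  hat := D.hatBaseChange g
  P := D.PBaseChange g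
  hasRank_one := D.hasRank_PBaseChange g
  rigid := D.rigid_PBaseChange g
  fibrewisePicZero := D.fibrewisePicZero_PBaseChange g
  universal := fun f' ℒ hℒ => D.universal_baseChange g f' ℒ hℒ

/-- The dual abelian scheme of the base change is `Â ×_S S'` (definitional). [cite: MumfordFogartyKirwan1994, Ch. 6 §1 Cor. 6.8 (p. 118)] -/
@[simp]
theorem baseChange_hat : (D.baseChange g).hat = D.hatBaseChange g := rfl

/-- The Poincaré sheaf of the base change is the pulled-back Poincaré sheaf (definitional).
[cite: MumfordFogartyKirwan1994, Ch. 6 §1 Cor. 6.8 (p. 118)] -/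
@[simp]
theorem baseChange_P : (D.baseChange g).P = D.PBaseChange g := rfl

/-- **The classifying map over `S'` projects to the classifying map over `S`**: for `ℒ` on `(A_{S'})_T`,
`g'_ℒ ≫ pr_Â = g_{ℒ.alongBaseChange}` (the formula consumers of the moduli interpretation use).
[cite: MilneAV2008, I §8 pp. 36–37] -/
theorem classify_baseChange_comp_fst {T : Scheme.{u}} (f' : T ⟶ S') (ℒ : (A.baseChange g).RigidifiedLineBundle f')
    (hℒ : ℒ.FibrewisePicZero) :
    (D.baseChange g).classify f' ℒ hℒ ≫ pullback.fst D.hat.X.hom g =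
      D.classify (f' ≫ g) ℒ.alongBaseChange (RigidifiedLineBundle.alongBaseChange_fibrewisePicZero hℒ) := by
  obtain ⟨i⟩ := (D.baseChange g).nonempty_pullbackP_classify_iso f' ℒ hℒ
  have hg' := (D.baseChange g).classify_comp_hom f' ℒ hℒ
  refine D.eq_classify (f' ≫ g) ℒ.alongBaseChange _ _ (D.comp_fst_comp_hat_hom_of_over g f' _ hg') ⟨?_⟩
  exact (A.pullbackHomPullbackInvIso g f' _).symm ≪≫
    (Scheme.Modules.pullback (A.bcHomLeft g f')).mapIso ((D.pullbackPBaseChangeIso g f' _ hg').symm ≪≫ i)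

end DualPair

end AbelianSchemeOver

end Literature.AlgebraicGeometry.AbelianSchemes

end
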